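import Mathlib
import Literature.Analysis.FluidPDE.TaoLocalisationHolds
import Literature.Analysis.FluidPDE.TaoFiniteEnergyLerayHopf
import Literature.Analysis.FluidPDE.NSVorticityBKMContinuation
import Literature.Analysis.FluidPDE.LipschitzSqIntegrableDecay
import Literature.Analysis.FluidPDE.EnstrophySplitting
import HarnessLib

/-!
# Route `TautLoopKelvin`, crux `TautLoopLaw` (stmt-NavierStokesRegularity-15249),
  line `Sketch-ideas-r1k1` (Dini–Saks architecture) — stub `stub_tautLoopSlabRegularity`

**Statement (slab regularity).** Let `ν, T > 0` and let `(u, p)` be a classical solution of the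
unforced Navier–Stokes system on `[0, T) × ℝ³` which is a Leray–Hopf solution on `[0, T)` from its
rapidly decaying datum `u 0`. Then

* (i) every slice `u t`, `t ∈ [0, T)`, tends to `0` at infinity;
* (ii) `t ↦ u t` is right-continuous in the sup norm at every `t ∈ [0, T)`:
  for every `κ > 0`, `sup_x ‖u s x - u t x‖ ≤ κ` for all `s > t` close to `t`.

**Proof.** Fix `t ∈ [0, T)` and the closed slab `[0, T']`, `T' = (t + T)/2`. On it `u` is a
classical solution (`IsClassicalNSSolutionOn.mono`) of finite energy (Leray–Hopf energy inequality
`IsLerayHopfOn.lintegral_enorm_sq_le`), so by Tao 2013, Cor. 11.1 + Cor. 4.3 + Thm. 5.4 (iv)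
(`tao2011_hasBoundedSobolevNormsOn_holds`) all spatial Sobolev norms of `u` are bounded on
`[0, T']`; by the Sobolev imbedding (`exists_forall_norm_fderiv_le_of_hasBoundedSobolevNormsOn`)
`‖Du‖ ≤ B` on `[0, T'] × ℝ³`, so every slice is `B`-Lipschitz; and a finite energy classical
solution on a closed slab is continuous into `L²` (`isLerayHopfOn_of_finiteEnergy`, Tao 2013,
Lemma 8.1 with Lemma 4.1 (i)). (i) A square-integrable Lipschitz field vanishes at infinity
(`tendsto_cocompact_of_lipschitzWith_of_integrable_sq`). (ii) The ball argument
(`tautLoopSlab_forall_norm_lt`): a `K`-Lipschitz field `f` with `‖f x₀‖ ≥ κ` has `‖f‖ ≥ κ/2` on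
`B(x₀, κ/(2K+2))`, hence `∫ ‖f‖² ≥ (κ/2)² |B(0, κ/(2K+2))|`; applied to `f = u s - u t`
(`2B`-Lipschitz) with `‖u s - u t‖_{L²} → 0` as `s → t` this gives `sup ‖u s - u t‖ < κ` for `s`
near `t`.
-/

noncomputable section

open Set MeasureTheory Filter Topology Function Metric Literature.Analysis.FluidPDE
open scoped ENNReal NNReal ContDiff

namespace Summit.NavierStokesRegularity.NavierStokesRegularity.Theorems

set_option linter.dupNamespace false

/-! ## The ball argument: `L²`-small Lipschitz fields are uniformly small -/

/-- **Ball argument.** If `f : ℝ³ → F` is `K`-Lipschitz and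
`∫⁻ ‖f‖ₑ² < (κ/2)² · |B(0, κ/(2K+2))|`, then `‖f x‖ < κ` everywhere: were `‖f x₀‖ ≥ κ`, then
`‖f‖ ≥ κ/2` on `B(x₀, κ/(2K+2))`, whose contribution to `∫ ‖f‖²` is already
`≥ (κ/2)² |B(0, κ/(2K+2))|`. [folklore] -/
theorem tautLoopSlab_forall_norm_lt {F : Type*} [NormedAddCommGroup F]
    {f : EuclideanSpace ℝ (Fin 3) → F} {K : ℝ≥0} (hK : LipschitzWith K f) {κ : ℝ} (hκ : 0 < κ)
    (hI : ∫⁻ x, ‖f x‖ₑ ^ 2 <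
      ENNReal.ofReal ((κ / 2) ^ 2) *
        volume (ball (0 : EuclideanSpace ℝ (Fin 3)) (κ / (2 * K + 2)))) :
    ∀ x, ‖f x‖ < κ := by
  intro x₀
  by_contra hge
  rw [not_lt] at hge
  set r : ℝ := κ / (2 * K + 2) with hr
  have hKr : (K : ℝ) * r ≤ κ / 2 := by
    rw [hr, mul_div_assoc', div_le_div_iff₀ (by positivity) (by positivity)]
    nlinarith [K.coe_nonneg]
  -- on `B(x₀, r)` the field stays above `κ / 2`
  have hlow : ∀ x ∈ ball x₀ r, ENNReal.ofReal ((κ / 2) ^ 2) ≤ ‖f x‖ₑ ^ 2 := by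
    intro x hx
    have h1 : ‖f x₀ - f x‖ ≤ K * r := by
      calc ‖f x₀ - f x‖ = dist (f x₀) (f x) := (dist_eq_norm _ _).symm
        _ ≤ K * dist x₀ x := hK.dist_le_mul x₀ x
        _ ≤ K * r := by
            refine mul_le_mul_of_nonneg_left ?_ K.coe_nonneg
            rw [dist_comm]
            exact (mem_ball.1 hx).le
    have h3 : κ / 2 ≤ ‖f x‖ := by
      have := norm_sub_norm_le (f x₀) (f x)
      linarith
    rw [← ofReal_norm, ← ENNReal.ofReal_pow (norm_nonneg _)]
    exact ENNReal.ofReal_le_ofReal (pow_le_pow_left₀ (by positivity) h3 2)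
  have hI' : ENNReal.ofReal ((κ / 2) ^ 2) * volume (ball (0 : EuclideanSpace ℝ (Fin 3)) r) ≤
      ∫⁻ x, ‖f x‖ₑ ^ 2 := by
    calc ENNReal.ofReal ((κ / 2) ^ 2) * volume (ball (0 : EuclideanSpace ℝ (Fin 3)) r)
        = ENNReal.ofReal ((κ / 2) ^ 2) * volume (ball x₀ r) := by
          rw [Measure.addHaar_ball_center volume x₀]
      _ = ∫⁻ _ in ball x₀ r, ENNReal.ofReal ((κ / 2) ^ 2) := (setLIntegral_const _ _).symm
      _ ≤ ∫⁻ x in ball x₀ r, ‖f x‖ₑ ^ 2 := setLIntegral_mono' measurableSet_ball hlow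
      _ ≤ ∫⁻ x, ‖f x‖ₑ ^ 2 := setLIntegral_le_lintegral _ _
  exact absurd hI (not_lt.2 hI')

/-! ## The common package on a closed slab `[0, T']`, `T' < T` -/

/-- **Slab package.** For a classical solution on `[0, T)` which is Leray–Hopf from its rapidly
decaying datum and `0 < T' < T`: all slices `u s`, `s ∈ [0, T']`, are Lipschitz with one constant
(Tao 2013, Cor. 11.1 + Cor. 4.3 + Thm. 5.4 (iv): bounded Sobolev norms on the closed slab; Sobolev
imbedding on `Du`), and `u ∈ C([0, T']; L²)` (Tao 2013, Lemma 8.1 with Lemma 4.1 (i): finite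
energy classical solutions on a closed slab are Leray–Hopf and continuous into `L²`). [folklore] -/
theorem tautLoopSlab_package {ν T : ℝ} (hν : 0 < ν)
    {u : ℝ → EuclideanSpace ℝ (Fin 3) → EuclideanSpace ℝ (Fin 3)}
    {p : ℝ → EuclideanSpace ℝ (Fin 3) → ℝ} (hcl : IsClassicalNSSolutionOn (Ico 0 T) ν 0 u p)
    (hLH : IsLerayHopfOn T ν 0 (u 0) u) (hdec : HasRapidSpatialDecay (u 0)) {T' : ℝ}
    (hT' : 0 < T') (hT'T : T' < T) :
    (∃ L : ℝ≥0, ∀ s ∈ Icc 0 T', LipschitzWith L (u s)) ∧ ContinuousInLpOn (Icc 0 T') 2 u := by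
  have hcl' : IsClassicalNSSolutionOn (Icc 0 T') ν 0 u p :=
    hcl.mono (Icc_subset_Ico_right hT'T) (uniqueDiffOn_Icc hT')
  have hE : ∀ t ∈ Icc 0 T',
      ∫⁻ x, ‖u t x‖ₑ ^ 2 ≤ ENNReal.ofReal (2 * VectorCalculus.kineticEnergy (u 0)) :=
    fun t ht => hLH.lintegral_enorm_sq_le hν.le ⟨ht.1, ht.2.trans hT'T.le⟩
  have hE' : ∃ C : ℝ≥0, ∀ t ∈ Icc 0 T', ∫⁻ x, ‖u t x‖ₑ ^ 2 ≤ C :=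
    ⟨(2 * VectorCalculus.kineticEnergy (u 0)).toNNReal, hE⟩
  have hH : HasBoundedSobolevNormsOn (Icc 0 T') u :=
    tao2011_hasBoundedSobolevNormsOn_holds hν hT' hcl' hE' hdec
  obtain ⟨B, hB0, hB⟩ := exists_forall_norm_fderiv_le_of_hasBoundedSobolevNormsOn
    (fun t ht => (hcl'.contDiff_velocity ht).of_le (by norm_cast)) hH
  refine ⟨⟨⟨B, hB0⟩, fun s hs => ?_⟩, ?_⟩
  · refine lipschitzWith_of_nnnorm_fderiv_le
      ((hcl'.contDiff_velocity hs).differentiable (by simp)) fun x => ?_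
    rw [← NNReal.coe_le_coe, coe_nnnorm]
    exact hB s hs x
  · exact (isLerayHopfOn_of_finiteEnergy hcl' hν hT' ⟨_, ENNReal.ofReal_lt_top, hE⟩).2

/-! ## (i) Decay of the slices and (ii) sup-norm right-continuity -/

/-- **(i) Every slice vanishes at infinity**: `u t ∈ L²` (Leray–Hopf) and `u t` is Lipschitz
(slab package), and a square-integrable Lipschitz field tends to `0` along the cocompact filter.
[folklore] -/
theorem tautLoopSlab_tendsto_cocompact {ν T : ℝ} (hν : 0 < ν)
    {u : ℝ → EuclideanSpace ℝ (Fin 3) → EuclideanSpace ℝ (Fin 3)}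
    {p : ℝ → EuclideanSpace ℝ (Fin 3) → ℝ} (hcl : IsClassicalNSSolutionOn (Ico 0 T) ν 0 u p)
    (hLH : IsLerayHopfOn T ν 0 (u 0) u) (hdec : HasRapidSpatialDecay (u 0)) {t : ℝ}
    (ht : t ∈ Ico 0 T) : Tendsto (u t) (cocompact (EuclideanSpace ℝ (Fin 3))) (𝓝 0) := by
  have hT' : 0 < (t + T) / 2 := by linarith [ht.1, ht.2]
  have hT'T : (t + T) / 2 < T := by linarith [ht.2]
  have htT' : t ∈ Icc 0 ((t + T) / 2) := ⟨ht.1, by linarith [ht.2]⟩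
  obtain ⟨⟨L, hL⟩, -⟩ := tautLoopSlab_package hν hcl hLH hdec hT' hT'T
  have hmem : MemLp (u t) 2 volume := hLH.memLp t ⟨ht.1, ht.2.le⟩
  exact tendsto_cocompact_of_lipschitzWith_of_integrable_sq (hL t htT')
    ((memLp_two_iff_integrable_sq_norm hmem.1).1 hmem)

/-- **(ii) Sup-norm right-continuity**: for `t ∈ [0, T)` and `κ > 0`, `‖u s x - u t x‖ ≤ κ` for all
`x` and all `s > t` close to `t` (ball argument on the `2L`-Lipschitz field `u s - u t`, whose `L²`
norm tends to `0` as `s → t` by the continuity of `u` into `L²` on `[0, (t+T)/2]`). [folklore] -/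
theorem tautLoopSlab_eventually_norm_sub_le {ν T : ℝ} (hν : 0 < ν)
    {u : ℝ → EuclideanSpace ℝ (Fin 3) → EuclideanSpace ℝ (Fin 3)}
    {p : ℝ → EuclideanSpace ℝ (Fin 3) → ℝ} (hcl : IsClassicalNSSolutionOn (Ico 0 T) ν 0 u p)
    (hLH : IsLerayHopfOn T ν 0 (u 0) u) (hdec : HasRapidSpatialDecay (u 0)) {t : ℝ}
    (ht : t ∈ Ico 0 T) {κ : ℝ} (hκ : 0 < κ) :
    ∀ᶠ s in 𝓝[>] t, ∀ x, ‖u s x - u t x‖ ≤ κ := by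
  have hT' : 0 < (t + T) / 2 := by linarith [ht.1, ht.2]
  have hT'T : (t + T) / 2 < T := by linarith [ht.2]
  have htT' : t ∈ Icc 0 ((t + T) / 2) := ⟨ht.1, by linarith [ht.2]⟩
  have htlt : t < (t + T) / 2 := by linarith [ht.2]
  obtain ⟨⟨L, hL⟩, hC⟩ := tautLoopSlab_package hν hcl hLH hdec hT' hT'T
  -- the threshold of the ball argument for `2L`-Lipschitz fields
  set δ : ℝ≥0∞ := ENNReal.ofReal ((κ / 2) ^ 2) *
    volume (ball (0 : EuclideanSpace ℝ (Fin 3)) (κ / (2 * (L + L : ℝ≥0) + 2))) with hδ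
  have hδ0 : 0 < δ := by
    refine ENNReal.mul_pos (ENNReal.ofReal_pos.2 (by positivity)).ne' ?_
    exact (measure_ball_pos volume _ (by positivity)).ne'
  -- `∫⁻ ‖u s - u t‖ₑ² → 0` as `s → t` within `[0, T']`
  have hlim : Tendsto (fun s => ∫⁻ x, ‖(u s - u t) x‖ₑ ^ 2) (𝓝[Icc 0 ((t + T) / 2)] t) (𝓝 0) := by
    have h2 := hC.2 t htT'
    have h3 : Tendsto (fun s => eLpNorm (u s - u t) 2 volume ^ 2) (𝓝[Icc 0 ((t + T) / 2)] t)
        (𝓝 (0 ^ 2)) := ((ENNReal.continuous_pow 2).tendsto 0).comp h2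
    rw [zero_pow two_ne_zero] at h3
    refine h3.congr' (Eventually.of_forall fun s => ?_)
    exact (lintegral_enorm_sq_eq_eLpNorm_two_sq volume (u s - u t)).symm
  have hev : ∀ᶠ s in 𝓝[Icc 0 ((t + T) / 2)] t, ∫⁻ x, ‖(u s - u t) x‖ₑ ^ 2 < δ :=
    (tendsto_order.1 hlim).2 δ hδ0
  have hle : 𝓝[>] t ≤ 𝓝[Icc 0 ((t + T) / 2)] t := by
    rw [← nhdsWithin_Ioo_eq_nhdsGT htlt]
    exact nhdsWithin_mono _ fun s hs => ⟨ht.1.trans hs.1.le, hs.2.le⟩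
  have hmem : ∀ᶠ s in 𝓝[>] t, s ∈ Ioo t ((t + T) / 2) := Ioo_mem_nhdsGT htlt
  filter_upwards [hev.filter_mono hle, hmem] with s hs hsI x
  have hlip : LipschitzWith (L + L) (fun y => u s y - u t y) :=
    (hL s ⟨ht.1.trans hsI.1.le, hsI.2.le⟩).sub (hL t htT')
  exact (tautLoopSlab_forall_norm_lt hlip hκ hs x).le

/-- **Slab regularity** (stub `stub_tautLoopSlabRegularity` of line `Sketch-ideas-r1k1`): for a
classical solution of Navier–Stokes on `[0, T) × ℝ³`, Leray–Hopf from its rapidly decaying datum,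
(i) every slice `u t`, `t ∈ [0, T)`, tends to `0` at infinity, and (ii) `s ↦ u s` is right-continuous
at every `t ∈ [0, T)` in the sup norm. [folklore] -/
theorem stub_tautLoopSlabRegularity : ∀ (ν T : ℝ), 0 < ν → 0 < T →
    ∀ (u : ℝ → EuclideanSpace ℝ (Fin 3) → EuclideanSpace ℝ (Fin 3))
      (p : ℝ → EuclideanSpace ℝ (Fin 3) → ℝ),
      Literature.Analysis.FluidPDE.IsClassicalNSSolutionOn (Set.Ico 0 T) ν 0 u p →
      Literature.Analysis.FluidPDE.IsLerayHopfOn T ν 0 (u 0) u →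
      Literature.Analysis.FluidPDE.HasRapidSpatialDecay (u 0) →
      (∀ t ∈ Set.Ico 0 T,
          Filter.Tendsto (u t) (Filter.cocompact (EuclideanSpace ℝ (Fin 3))) (nhds 0)) ∧
        (∀ t ∈ Set.Ico 0 T, ∀ κ : ℝ, 0 < κ →
          ∀ᶠ s in nhdsWithin t (Set.Ioi t), ∀ x, ‖u s x - u t x‖ ≤ κ) := by
  intro ν T hν _hT u p hcl hLH hdec
  exact ⟨fun t ht => tautLoopSlab_tendsto_cocompact hν hcl hLH hdec ht,
    fun t ht κ hκ => tautLoopSlab_eventually_norm_sub_le hν hcl hLH hdec ht hκ⟩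

end Summit.NavierStokesRegularity.NavierStokesRegularity.Theorems

end
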